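import Summits.AtomisticToContinuum.FouriersLaw.Theses.BondHeatUncertainty

/-!
# `LinearResponseFTUR` (stmt-AtomisticToContinuum-9122): the `K = 0` corner is consistent

Support lemma from the standing disprover of crux (★) `LinearResponseFTUR` of route
`BondHeatUncertainty` (file `Cruxes/LinearResponseFTUR/Disproof.lean`, §(d)).

The abstract shape of conclusion (b), `2G²t² ≤ V(t)(G t/T² + K)`, is FALSE with `K = 0` as soon as
`G > 0` (the plain finite-time TUR fails for underdamped chains: `V(t) = ⟨j_b²⟩t² + O(t³)` near `0`).
The crux is nevertheless consistent at that corner, on its actual objects and WITHOUT the uniqueness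
hypothesis: if `K = 0` is admissible, i.e. `KL(μ_{N,δ} ‖ Θ_*μ_{N,δ}) ≤ 0·δ²` eventually, then
`μ_{N,δ} = Θ_*μ_{N,δ}` (converse Gibbs inequality), a momentum-flip invariant state carries no current
(`j_b ∘ Θ = -j_b`), so `totalCurrent = 0` eventually and the response coefficient `D N` is `0`:
conclusion (b) with `K = 0` reads `0 ≤ 0`. Provers of (★) may therefore assume `0 < K`.
-/

namespace Summit.AtomisticToContinuum.FouriersLaw.Theorems.LinearResponseFTUR.Negative

open MeasureTheory Filter
open Literature.MathematicalPhysics.KineticTheory.HeatConduction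

/-- Mean bond currents change sign under the push-forward by momentum reversal `Θ(q,p) = (q,-p)`
(any chain, any measure; both sides are Bochner integrals, junk included). -/
theorem integral_bondCurrent_map_momentumFlip (P : OscillatorChain) {N : ℕ}
    (μ : Measure (PhaseSpace N)) (i : Fin N) :
    ∫ x, P.bondCurrent N i x ∂(Measure.map (fun x : PhaseSpace N => (x.1, -x.2)) μ) =
      -∫ x, P.bondCurrent N i x ∂μ := by
  have e : (fun x : PhaseSpace N => (x.1, -x.2)) = ⇑(momentumReversal N) := by
    funext x; rfl
  rw [e, MeasureTheory.integral_map_equiv, ← integral_neg]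
  refine integral_congr_ae (Eventually.of_forall fun x => ?_)
  show P.bondCurrent N i ((momentumReversal N) x) = -P.bondCurrent N i x
  rw [momentumReversal_apply]
  exact P.bondCurrent_neg_momentum N i x

/-- A momentum-flip invariant state carries no current. -/
theorem totalCurrent_eq_zero_of_momentumFlip_invariant (P : OscillatorChain) {N : ℕ}
    (μ : Measure (PhaseSpace N)) (h : μ = Measure.map (fun x : PhaseSpace N => (x.1, -x.2)) μ) :
    P.totalCurrent μ = 0 := by
  unfold OscillatorChain.totalCurrent
  refine Finset.sum_eq_zero fun i _ => ?_
  have h1 := integral_bondCurrent_map_momentumFlip P μ i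
  rw [← h] at h1
  linarith

/-- **`K = 0` admissible forces zero response.** For any chain `P`, any family `μ N T_L T_R` of weak
steady states (only `IsProbabilityMeasure` is used) and `T > 0`: if
`KL(μ_{T+δ/2,T-δ/2} ‖ Θ_*μ_{T+δ/2,T-δ/2}) ≤ 0·δ²` for all small `δ ≠ 0` (the hypothesis of conclusion (b)
of `LinearResponseFTUR` with `K = 0`), then the linear-response coefficient
`D = lim_{δ→0} totalCurrent(μ_{T+δ/2,T-δ/2})/δ` vanishes. -/
theorem response_eq_zero_of_klDiv_le_zero (P : OscillatorChain)
    (μ : (N : ℕ) → ℝ → ℝ → Measure (PhaseSpace N))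
    (hμ : ∀ (N : ℕ) (T_L T_R : ℝ), 0 < T_L → 0 < T_R → P.IsSteadyState N T_L T_R (μ N T_L T_R))
    {T : ℝ} (hT : 0 < T) {N : ℕ} {D : ℝ}
    (hD : Tendsto (fun δ : ℝ => P.totalCurrent (μ N (T + δ / 2) (T - δ / 2)) / δ)
      (nhdsWithin 0 {(0 : ℝ)}ᶜ) (nhds D))
    (hKL : ∀ᶠ δ in nhdsWithin (0 : ℝ) {(0 : ℝ)}ᶜ,
      InformationTheory.klDiv (μ N (T + δ / 2) (T - δ / 2))
        (Measure.map (fun x : PhaseSpace N => (x.1, -x.2)) (μ N (T + δ / 2) (T - δ / 2)))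
        ≤ ENNReal.ofReal (0 * δ ^ 2)) :
    D = 0 := by
  have h2T : ∀ᶠ δ in nhdsWithin (0 : ℝ) {(0 : ℝ)}ᶜ, 0 < T + δ / 2 ∧ 0 < T - δ / 2 := by
    have h1 : ∀ᶠ δ in nhds (0 : ℝ), δ < 2 * T := eventually_lt_nhds (by linarith)
    have h2 : ∀ᶠ δ in nhds (0 : ℝ), -(2 * T) < δ := eventually_gt_nhds (by linarith)
    refine mem_nhdsWithin_of_mem_nhds ?_
    filter_upwards [h1, h2] with δ ha hb
    exact ⟨by linarith, by linarith⟩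
  have hev : ∀ᶠ δ in nhdsWithin (0 : ℝ) {(0 : ℝ)}ᶜ,
      P.totalCurrent (μ N (T + δ / 2) (T - δ / 2)) / δ = 0 := by
    filter_upwards [hKL, h2T] with δ hδ hab
    have hss := hμ N _ _ hab.1 hab.2
    haveI : IsProbabilityMeasure (μ N (T + δ / 2) (T - δ / 2)) := hss.1
    have h0 : InformationTheory.klDiv (μ N (T + δ / 2) (T - δ / 2))
        (Measure.map (fun x : PhaseSpace N => (x.1, -x.2)) (μ N (T + δ / 2) (T - δ / 2))) = 0 := by
      rw [zero_mul, ENNReal.ofReal_zero] at hδ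
      exact le_antisymm hδ bot_le
    have heq := (InformationTheory.klDiv_eq_zero_iff).mp h0
    rw [totalCurrent_eq_zero_of_momentumFlip_invariant P _ heq, zero_div]
  have hlim : Tendsto (fun δ : ℝ => P.totalCurrent (μ N (T + δ / 2) (T - δ / 2)) / δ)
      (nhdsWithin 0 {(0 : ℝ)}ᶜ) (nhds 0) :=
    (tendsto_congr' hev).mpr tendsto_const_nhds
  exact tendsto_nhds_unique hD hlim

/-- **Corollary on the crux's own hypotheses**: along the hypotheses of `LinearResponseFTUR`
(uniqueness is not even needed), an admissible `K = 0` at length `N` gives `D N = 0`, whence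
conclusion (b) of the crux at `K = 0` holds trivially: both sides are `0`. -/
theorem linearResponseFTUR_conclusion_b_at_K_zero {ω₂ lam β γ : ℝ}
    (μ : (N : ℕ) → ℝ → ℝ → Measure (PhaseSpace N))
    (hμ : ∀ (N : ℕ) (T_L T_R : ℝ), 0 < T_L → 0 < T_R →
      (pinnedChain ω₂ lam β γ).IsSteadyState N T_L T_R (μ N T_L T_R))
    {T : ℝ} (hT : 0 < T) (D : ℕ → ℝ)
    (hD : ∀ N : ℕ, Tendsto (fun δ : ℝ =>
      (pinnedChain ω₂ lam β γ).totalCurrent (μ N (T + δ / 2) (T - δ / 2)) / δ)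
      (nhdsWithin 0 {(0 : ℝ)}ᶜ) (nhds (D N)))
    {N : ℕ}
    (hKL : ∀ᶠ δ in nhdsWithin (0 : ℝ) {(0 : ℝ)}ᶜ,
      InformationTheory.klDiv (μ N (T + δ / 2) (T - δ / 2))
        (Measure.map (fun x : PhaseSpace N => (x.1, -x.2)) (μ N (T + δ / 2) (T - δ / 2)))
        ≤ ENNReal.ofReal (0 * δ ^ 2))
    (V : ℝ) (t : ℝ) :
    2 * (D N / ((N : ℝ) - 1)) ^ 2 * t ^ 2 ≤ V * (D N / ((N : ℝ) - 1) * t / T ^ 2 + 0) := by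
  have hD0 : D N = 0 := response_eq_zero_of_klDiv_le_zero (pinnedChain ω₂ lam β γ) μ hμ hT (hD N) hKL
  simp [hD0]

end Summit.AtomisticToContinuum.FouriersLaw.Theorems.LinearResponseFTUR.Negative
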